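import Mathlib
import Literature.Analysis.FluidPDE.Tao2016AveragedNS.ShiftSetCascadeFlows
import Summits.NavierStokesRegularity.NavierStokesRegularity.Theorems.TaoLadderRungTwoFlatMirrorTableDefs
import Summits.NavierStokesRegularity.NavierStokesRegularity.Theorems.TaoLadderRungTwoFlatQuadPolarOn
import Summits.NavierStokesRegularity.NavierStokesRegularity.Theorems.TaoLadderRungTwoFlatPulseDefs
import HarnessLib

/-!
# Uniqueness of bounded solutions of the linearised homogeneous lattice equation (any shift set)
  (helper for item stmt-NavierStokesRegularity-22987 `FlatGapCertificatesV2`, crux K_A♭ of route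
  TaoLadderRungTwoFlat; cell harvest/h2-tao-ladder, p1 g19)

The (S2) predicate `MirrorPulse.LinearisedHopContraction` quantifies over ALL bounded solutions of the
variational equation `u̇ = Lin_Φ(u)` along the pulse. For a finite-window certificate of (S2) to be SOUND one
needs that these solutions are determined by their initial data: the infinite lattice is only
nearest-neighbour coupled, so a Picard–Gronwall iteration in the sup norm over ALL sites gives, at scale ratio
`1` (all clocks `1`, any shift set `𝕊`, any table `α`, any bounded continuous background `Φ`):

* `abs_bilinOn_zero_le` — `|B(X,Y)_{i,n}(t)| ≤ ‖α‖₁ · M_X · M_Y` for globally bounded slots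
  (`‖α‖₁ = tableAbsSum α`, the sum of all `|α|`);
* `abs_le_pow_div_factorial` — a solution bounded by `M_u` on `[0,T]` with `u(0) = 0` obeys
  `|u_{i,n}(s)| ≤ M_u (L s)^j / j!` for every `j` (`L = 2‖α‖₁ M_Φ`);
* `eq_zero_of_linearised` — hence `u ≡ 0` on `[0, T]`; `linearised_unique` — two bounded solutions with the
  same data agree on `[0, T]`; `MirrorPulse.isVariationalOn_unique` — the corollary for the typed predicate.

HONEST FRAMING: elementary real analysis (FTC + factorial majorants) for a MODEL lattice; nothing is certified
and nothing is a statement about the Navier–Stokes equations.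
-/

noncomputable section

-- the sub-problem namespace repeats the summit name by design (D-0017)
set_option linter.dupNamespace false

namespace Summit.NavierStokesRegularity.NavierStokesRegularity.Theorems

open Set Filter Literature.Analysis.FluidPDE Literature.Analysis.FluidPDE.TaoCascade
open scoped Topology Nat

namespace QuadPolar

variable {m : ℕ}

/-- The `ℓ¹` size of a table over the shift set: `Σ_{i₁,i₂,i} Σ_{μ∈𝕊} |α i₁ i₂ i μ|`.
[cite: Tao2016AveragedNS, §4 (4.1); cell vocabulary] -/
def tableAbsSum (𝕊 : Finset (ℤ × ℤ × ℤ)) (α : Fin m → Fin m → Fin m → ℤ × ℤ × ℤ → ℝ) : ℝ :=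
  ∑ i : Fin m, ∑ i₁ : Fin m, ∑ i₂ : Fin m, ∑ μ ∈ 𝕊, |α i₁ i₂ i μ|

/-- `tableAbsSum` is nonnegative. [cite: Tao2016AveragedNS, §4 (4.1)] -/
theorem tableAbsSum_nonneg (𝕊 : Finset (ℤ × ℤ × ℤ)) (α : Fin m → Fin m → Fin m → ℤ × ℤ × ℤ → ℝ) :
    0 ≤ tableAbsSum 𝕊 α := by
  unfold tableAbsSum; positivity

/-- **Size of the polarisation at scale ratio `1`**: for slots bounded by `M_X`, `M_Y` at time `t`,
`|B(X,Y)_{i,n}(t)| ≤ ‖α‖₁ · M_X · M_Y`. [cite: Tao2016AveragedNS, §4 (4.8)] -/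
theorem abs_bilinOn_zero_le (𝕊 : Finset (ℤ × ℤ × ℤ)) (α : Fin m → Fin m → Fin m → ℤ × ℤ × ℤ → ℝ)
    {X Y : Fin m → ℤ → ℝ → ℝ} {MX MY : ℝ} {t : ℝ} (hX : ∀ j k, |X j k t| ≤ MX) (hY : ∀ j k, |Y j k t| ≤ MY)
    (i : Fin m) (n : ℤ) : |bilinOn 𝕊 0 α X Y i n t| ≤ tableAbsSum 𝕊 α * MX * MY := by
  classical
  have hMX : 0 ≤ MX := (abs_nonneg _).trans (hX i n)
  have hMY : 0 ≤ MY := (abs_nonneg _).trans (hY i n)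
  unfold bilinOn
  have hterm : ∀ (i₁ i₂ : Fin m) (μ : ℤ × ℤ × ℤ),
      |α i₁ i₂ i μ * (1 + (0 : ℝ)) ^ ((5 : ℝ) * (n - μ.2.2) / 2) *
          (X i₁ (n - μ.2.2 + μ.1) t * Y i₂ (n - μ.2.2 + μ.2.1) t)| ≤ |α i₁ i₂ i μ| * (MX * MY) := by
    intro i₁ i₂ μ
    rw [add_zero, Real.one_rpow, mul_one, abs_mul, abs_mul]
    exact mul_le_mul_of_nonneg_left (mul_le_mul (hX _ _) (hY _ _) (abs_nonneg _) hMX) (abs_nonneg _)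
  calc |∑ i₁, ∑ i₂, ∑ μ ∈ 𝕊, α i₁ i₂ i μ * (1 + (0 : ℝ)) ^ ((5 : ℝ) * (n - μ.2.2) / 2) *
          (X i₁ (n - μ.2.2 + μ.1) t * Y i₂ (n - μ.2.2 + μ.2.1) t)|
      ≤ ∑ i₁, ∑ i₂, ∑ μ ∈ 𝕊, |α i₁ i₂ i μ| * (MX * MY) := by
        refine (Finset.abs_sum_le_sum_abs _ _).trans (Finset.sum_le_sum fun i₁ _ => ?_)
        refine (Finset.abs_sum_le_sum_abs _ _).trans (Finset.sum_le_sum fun i₂ _ => ?_)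
        exact (Finset.abs_sum_le_sum_abs _ _).trans (Finset.sum_le_sum fun μ _ => hterm i₁ i₂ μ)
    _ = (∑ i₁, ∑ i₂, ∑ μ ∈ 𝕊, |α i₁ i₂ i μ|) * MX * MY := by
        simp only [← Finset.sum_mul]; ring
    _ ≤ tableAbsSum 𝕊 α * MX * MY := by
        have hle : (∑ i₁, ∑ i₂, ∑ μ ∈ 𝕊, |α i₁ i₂ i μ|) ≤ tableAbsSum 𝕊 α := by
          unfold tableAbsSum
          exact Finset.single_le_sum (f := fun i => ∑ i₁, ∑ i₂, ∑ μ ∈ 𝕊, |α i₁ i₂ i μ|)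
            (fun _ _ => by positivity) (Finset.mem_univ i)
        gcongr

/-- Size of the linearisation at scale ratio `1`: `|Lin_Φ(u)_{i,n}(t)| ≤ 2‖α‖₁ M_Φ M_u`.
[cite: Tao2016AveragedNS, §4 (4.8)] -/
theorem abs_linTermOn_zero_le (𝕊 : Finset (ℤ × ℤ × ℤ)) (α : Fin m → Fin m → Fin m → ℤ × ℤ × ℤ → ℝ)
    {Φ u : Fin m → ℤ → ℝ → ℝ} {MΦ Mu : ℝ} {t : ℝ} (hΦ : ∀ j k, |Φ j k t| ≤ MΦ) (hu : ∀ j k, |u j k t| ≤ Mu)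
    (i : Fin m) (n : ℤ) : |linTermOn 𝕊 0 α Φ u i n t| ≤ 2 * tableAbsSum 𝕊 α * MΦ * Mu := by
  unfold linTermOn
  have h1 := abs_bilinOn_zero_le 𝕊 α hΦ hu i n
  have h2 := abs_bilinOn_zero_le 𝕊 α hu hΦ i n
  calc |bilinOn 𝕊 0 α Φ u i n t + bilinOn 𝕊 0 α u Φ i n t|
      ≤ |bilinOn 𝕊 0 α Φ u i n t| + |bilinOn 𝕊 0 α u Φ i n t| := abs_add_le _ _
    _ ≤ tableAbsSum 𝕊 α * MΦ * Mu + tableAbsSum 𝕊 α * Mu * MΦ := add_le_add h1 h2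
    _ = 2 * tableAbsSum 𝕊 α * MΦ * Mu := by ring

/-- The linearisation along a continuous background of a continuous family is continuous in time.
[cite: Tao2016AveragedNS, §4 (4.8)] -/
theorem continuous_linTermOn (𝕊 : Finset (ℤ × ℤ × ℤ)) (ε₀ : ℝ)
    (α : Fin m → Fin m → Fin m → ℤ × ℤ × ℤ → ℝ) {Φ u : Fin m → ℤ → ℝ → ℝ}
    (hΦ : ∀ j k, Continuous (Φ j k)) (hu : ∀ j k, Continuous (u j k)) (i : Fin m) (n : ℤ) :
    Continuous fun t => linTermOn 𝕊 ε₀ α Φ u i n t := by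
  unfold linTermOn bilinOn
  refine Continuous.add ?_ ?_ <;>
    refine continuous_finsetSum _ fun i₁ _ => continuous_finsetSum _ fun i₂ _ =>
      continuous_finsetSum _ fun μ _ => ?_
  · exact continuous_const.mul ((hΦ _ _).mul (hu _ _))
  · exact continuous_const.mul ((hu _ _).mul (hΦ _ _))

/-- **The factorial majorants.** A solution of `u̇ = Lin_Φ(u)` (scale ratio `1`) with `u(0) = 0`, bounded by
`M_u` on `[0, T]`, along a continuous background bounded by `M_Φ`, satisfies `|u_{i,n}(s)| ≤ M_u (L s)^j / j!`
on `[0, T]` for every `j`, with `L = 2‖α‖₁ M_Φ`. [cite: Tao2016AveragedNS, §4 (4.8); folklore (Picard iteration)] -/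
theorem abs_le_pow_div_factorial (𝕊 : Finset (ℤ × ℤ × ℤ)) (α : Fin m → Fin m → Fin m → ℤ × ℤ × ℤ → ℝ)
    {Φ u : Fin m → ℤ → ℝ → ℝ} {MΦ Mu T : ℝ} (hΦc : ∀ j k, Continuous (Φ j k))
    (hΦ : ∀ j k t, |Φ j k t| ≤ MΦ)
    (hder : ∀ i n t, HasDerivAt (u i n) (linTermOn 𝕊 0 α Φ u i n t) t)
    (hbdd : ∀ i n, ∀ t ∈ Icc 0 T, |u i n t| ≤ Mu) (h0 : ∀ i n, u i n 0 = 0) :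
    ∀ (j : ℕ) (i : Fin m) (n : ℤ), ∀ s ∈ Icc 0 T,
      |u i n s| ≤ Mu * (2 * tableAbsSum 𝕊 α * MΦ * s) ^ j / j ! := by
  set L := 2 * tableAbsSum 𝕊 α * MΦ with hL
  have huc : ∀ j k, Continuous (u j k) := fun j k =>
    continuous_iff_continuousAt.2 fun t => (hder j k t).continuousAt
  have hLc : ∀ i n, Continuous fun t => linTermOn 𝕊 0 α Φ u i n t :=
    fun i n => continuous_linTermOn 𝕊 0 α hΦc huc i n
  intro j
  induction j with
  | zero =>
    intro i n s hs
    simpa using hbdd i n s hs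
  | succ j ih =>
    intro i n s hs
    have hs0 : 0 ≤ s := hs.1
    have hMΦ : 0 ≤ MΦ := (abs_nonneg _).trans (hΦ i n 0)
    have hL0 : 0 ≤ L := by rw [hL]; have := tableAbsSum_nonneg 𝕊 α; positivity
    have hMu : 0 ≤ Mu := (abs_nonneg _).trans (hbdd i n 0 ⟨le_rfl, hs0.trans hs.2⟩)
    -- FTC: u(s) = ∫₀ˢ Lin
    have hftc : ∫ σ in (0 : ℝ)..s, linTermOn 𝕊 0 α Φ u i n σ = u i n s - u i n 0 :=
      intervalIntegral.integral_eq_sub_of_hasDerivAt (fun σ _ => hder i n σ) ((hLc i n).intervalIntegrable _ _)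
    rw [h0 i n, sub_zero] at hftc
    -- pointwise bound of the integrand on [0, s] from the level-j bound
    have hpt : ∀ σ ∈ Icc 0 s, |linTermOn 𝕊 0 α Φ u i n σ| ≤ L * (Mu * (L * σ) ^ j / j !) := by
      intro σ hσ
      have hσT : σ ∈ Icc 0 T := ⟨hσ.1, hσ.2.trans hs.2⟩
      have hb := abs_linTermOn_zero_le 𝕊 α (fun j' k => hΦ j' k σ) (fun j' k => ih j' k σ hσT) i n
      calc |linTermOn 𝕊 0 α Φ u i n σ| ≤ 2 * tableAbsSum 𝕊 α * MΦ * (Mu * (L * σ) ^ j / j !) := hb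
        _ = L * (Mu * (L * σ) ^ j / j !) := by rw [hL]
    -- integrate the majorant
    have hint : ∫ σ in (0 : ℝ)..s, L * (Mu * (L * σ) ^ j / j !) = Mu * (L * s) ^ (j + 1) / (j + 1)! := by
      have e : (fun σ : ℝ => L * (Mu * (L * σ) ^ j / j !)) = fun σ => (L ^ (j + 1) * Mu / j !) * σ ^ j := by
        funext σ; rw [mul_pow]; ring
      rw [e, intervalIntegral.integral_const_mul, integral_pow, Nat.factorial_succ]
      push_cast
      rw [zero_pow (Nat.succ_ne_zero j), sub_zero, mul_pow]
      field_simp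
      rw [hL]
      ring
    calc |u i n s| = |∫ σ in (0 : ℝ)..s, linTermOn 𝕊 0 α Φ u i n σ| := by rw [hftc]
      _ ≤ ∫ σ in (0 : ℝ)..s, |linTermOn 𝕊 0 α Φ u i n σ| :=
          intervalIntegral.abs_integral_le_integral_abs hs0
      _ ≤ ∫ σ in (0 : ℝ)..s, L * (Mu * (L * σ) ^ j / j !) := by
          refine intervalIntegral.integral_mono_on hs0 ?_ ?_ hpt
          · exact ((hLc i n).abs).intervalIntegrable _ _
          · exact (continuous_const.mul ((continuous_const.mul
              ((continuous_const.mul continuous_id).pow j)).div_const _)).intervalIntegrable _ _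
      _ = Mu * (L * s) ^ (j + 1) / (j + 1)! := hint

/-- **Bounded solutions with zero data vanish**: `u̇ = Lin_Φ(u)` at scale ratio `1`, `u(0) = 0`, `u` bounded on
`[0, T]`, background continuous and bounded ⟹ `u ≡ 0` on `[0, T]`. [cite: Tao2016AveragedNS, §4 (4.8); folklore (Gronwall)] -/
theorem eq_zero_of_linearised (𝕊 : Finset (ℤ × ℤ × ℤ)) (α : Fin m → Fin m → Fin m → ℤ × ℤ × ℤ → ℝ)
    {Φ u : Fin m → ℤ → ℝ → ℝ} {MΦ Mu T : ℝ} (hΦc : ∀ j k, Continuous (Φ j k))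
    (hΦ : ∀ j k t, |Φ j k t| ≤ MΦ)
    (hder : ∀ i n t, HasDerivAt (u i n) (linTermOn 𝕊 0 α Φ u i n t) t)
    (hbdd : ∀ i n, ∀ t ∈ Icc 0 T, |u i n t| ≤ Mu) (h0 : ∀ i n, u i n 0 = 0)
    (i : Fin m) (n : ℤ) {s : ℝ} (hs : s ∈ Icc 0 T) : u i n s = 0 := by
  have hmaj := fun j => abs_le_pow_div_factorial 𝕊 α hΦc hΦ hder hbdd h0 j i n s hs
  have hlim : Tendsto (fun j : ℕ => Mu * (2 * tableAbsSum 𝕊 α * MΦ * s) ^ j / j !) atTop (𝓝 0) := by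
    have h := (Real.summable_pow_div_factorial (2 * tableAbsSum 𝕊 α * MΦ * s)).tendsto_atTop_zero
    have h2 := h.const_mul Mu
    rw [mul_zero] at h2
    refine h2.congr fun j => ?_
    ring
  have hle : |u i n s| ≤ 0 :=
    ge_of_tendsto' hlim fun j => hmaj j
  exact abs_nonpos_iff.mp hle

/-- **Uniqueness of bounded solutions of the linearised equation** (scale ratio `1`, any shift set and table):
two solutions of `u̇ = Lin_Φ(u)` with the same data at time `0`, both bounded on `[0, T]`, agree on `[0, T]`.
[cite: Tao2016AveragedNS, §4 (4.8); folklore (Gronwall)] -/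
theorem linearised_unique (𝕊 : Finset (ℤ × ℤ × ℤ)) (α : Fin m → Fin m → Fin m → ℤ × ℤ × ℤ → ℝ)
    {Φ u v : Fin m → ℤ → ℝ → ℝ} {MΦ Mu Mv T : ℝ} (hΦc : ∀ j k, Continuous (Φ j k))
    (hΦ : ∀ j k t, |Φ j k t| ≤ MΦ)
    (hu : ∀ i n t, HasDerivAt (u i n) (linTermOn 𝕊 0 α Φ u i n t) t)
    (hv : ∀ i n t, HasDerivAt (v i n) (linTermOn 𝕊 0 α Φ v i n t) t)
    (hub : ∀ i n, ∀ t ∈ Icc 0 T, |u i n t| ≤ Mu) (hvb : ∀ i n, ∀ t ∈ Icc 0 T, |v i n t| ≤ Mv)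
    (h0 : ∀ i n, u i n 0 = v i n 0) (i : Fin m) (n : ℤ) {s : ℝ} (hs : s ∈ Icc 0 T) :
    u i n s = v i n s := by
  -- the difference solves the linearised equation with zero data
  set w : Fin m → ℤ → ℝ → ℝ := fun i n t => u i n t - v i n t with hw
  have hlin : ∀ i n t, linTermOn 𝕊 0 α Φ w i n t = linTermOn 𝕊 0 α Φ u i n t - linTermOn 𝕊 0 α Φ v i n t := by
    intro i n t
    have e : w = u + (-1 : ℝ) • v := by funext i n t; simp [hw]; ring
    rw [e, linTermOn_add, linTermOn_smul]
    ring
  have hder : ∀ i n t, HasDerivAt (w i n) (linTermOn 𝕊 0 α Φ w i n t) t := by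
    intro i n t
    rw [hlin]
    exact (hu i n t).sub (hv i n t)
  have hbdd : ∀ i n, ∀ t ∈ Icc 0 T, |w i n t| ≤ Mu + Mv := fun i n t ht =>
    (abs_sub _ _).trans (add_le_add (hub i n t ht) (hvb i n t ht))
  have hw0 : ∀ i n, w i n 0 = 0 := fun i n => by simp [hw, h0 i n]
  have := eq_zero_of_linearised 𝕊 α hΦc hΦ hder hbdd hw0 i n hs
  simp only [hw] at this
  linarith

end QuadPolar

namespace MirrorPulse

/-- **(S2)'s solution class is a uniqueness class**: along a bounded global solution `Φ` of the homogeneous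
mirror lattice, two variational solutions (`IsVariationalOn ε T Φ ·`) with the same data at time `0` agree on
`[0, T]`. So the linearised hop operator of a finite-window certificate captures every solution the predicate
`LinearisedHopContraction` quantifies over. [cite: Tao2016AveragedNS, §4 (4.8); route TaoLadderRungTwoFlat, λ₀ = 1 layer (S2)] -/
theorem isVariationalOn_unique {ε T : ℝ} {Φ u v : Fin 2 → ℤ → ℝ → ℝ} (hΦ : IsGlobalSol ε Φ)
    (hb : IsBddFam Φ) (hu : IsVariationalOn ε T Φ u) (hv : IsVariationalOn ε T Φ v)
    (h0 : ∀ i n, u i n 0 = v i n 0) (i : Fin 2) (n : ℤ) {s : ℝ} (hs : s ∈ Icc 0 T) :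
    u i n s = v i n s := by
  obtain ⟨M, hM⟩ := hb
  obtain ⟨hud, Mu, hub⟩ := hu
  obtain ⟨hvd, Mv, hvb⟩ := hv
  have hΦc : ∀ j k, Continuous (Φ j k) := fun j k =>
    continuous_iff_continuousAt.2 fun t => (hΦ j k t).continuousAt
  exact QuadPolar.linearised_unique shiftSetFlat (mirrorTable ε ε) hΦc hM hud hvd hub hvb h0 i n hs

end MirrorPulse

end Summit.NavierStokesRegularity.NavierStokesRegularity.Theorems

end
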